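import Mathlib
import Literature.MathematicalPhysics.StatisticalMechanics.HcpHomogeneous

/-!
# Exact local rules give a global chart — stub `stub_exactLocalRules` of line `vanishing-excess-truss-rigidity` (crux `CoarseGrains`, stmt-AtomisticToContinuum-9331)

A Dolbilin–Lagarias–Senechal-type "local rules ⇒ regular system" statement (shape of DLS 1998,
Thm 1.3) for the relaxed hexagonal close packing `P = hcp(a,h)` on the box `47/50 ≤ a ≤ 1`,
`39/50·a ≤ h ≤ 17/20·a`: given *key rigidity* (a linear isometry mapping `P ∩ B̄_{5/2}` into `P`
and onto `P ∩ B̄_{5/2}` is a symmetry of `P`; a hypothesis here — Stub D of the line), a set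
`X ∋ 0` which at each of its points `x` with `‖x‖ ≤ R + 6` coincides on `B°₄(x)` with
`x + A_x(P)`, `A_x` a linear isometry, is charted two-way on `B̄_{R+1}` by ONE linear isometry.

Proof.  Take the chart `A = A₀` at `0` and propagate `C(q)`: "`X` and `A(P)` agree on `B°₄(A q)`"
from `q = 0` to all sites `q ∈ P` with `‖q‖ ≤ R + 6`:
* `exactLR_step`: `C(q') ⇒ C(q)` if `dist q q' ≤ 11/10` — compare the chart `A_x` at `x = A q`
  with `A ∘ B_q`, where `P − q = B_q P` (`hcpPeriodicConfiguration_homogeneous`), through the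
  linear isometry `g = B_q⁻¹ A⁻¹ A_x` (`LinearIsometry.toLinearIsometryEquiv`); key rigidity
  applies to `g` because `B̄_{5/2 + 11/10}(A q) ⊆ B°₄(A q')`, so `g` is a symmetry of `P`;
* `exactLR_propagate`: induction on `⌈5‖q‖²⌉` along the descent lemma (G1) `exactLR_descent`
  (every site `q ≠ 0` has a site at distance `≤ 11/10` with `‖·‖²` smaller by `≥ 1/5`);
* conclusion with the crude covering radius `11/5` (G2) `exactLR_covering`: every
  `y ∈ X ∩ B̄_{R+1}` is seen from a site `q` with `‖q‖ ≤ R + 6`.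
(G1), (G2) are computed in coordinates (`dist_barlowPos_sq`, `haggLabel_alternating_of_even/odd`).
Sources: DLS 1998, Thm 1.3 (shape); Conway–Sloane Ch. 1 §1.3, Hales *DSP* §1.3 (hcp). [folklore]
-/

noncomputable section

namespace Summit.AtomisticToContinuum.Crystallization.Theorems.ExcessDecayLiouvilleCoarseGrains

open Literature.MathematicalPhysics.StatisticalMechanics

/-- The origin is the site `(0,0,0)` of hcp. [folklore] -/
theorem exactLR_barlowPos_zero (a h : ℝ) : barlowPos a h alternatingHagg 0 0 0 = 0 := by
  simp [barlowPos]

/-- Squared norm of an hcp site in coordinates (general label `L = haggLabel k`):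
`‖site (i,j) of layer k‖² = a²(i² + ij + j² + L(i+j) + L²/3) + k²h²`. [folklore] -/
theorem exactLR_norm_barlowPos_sq (a h : ℝ) (k i j : ℤ) :
    ‖barlowPos a h alternatingHagg k i j‖ ^ 2 =
      a ^ 2 * ((i : ℝ) ^ 2 + i * j + (j : ℝ) ^ 2 +
        (haggLabel alternatingHagg k : ℝ) * (i + j) + (haggLabel alternatingHagg k : ℝ) ^ 2 / 3) +
      (k : ℝ) ^ 2 * h ^ 2 := by
  rw [← dist_zero_right, ← exactLR_barlowPos_zero a h, dist_barlowPos_sq]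
  have h3 : (√3 : ℝ) ^ 2 = 3 := Real.sq_sqrt (by norm_num)
  simp only [haggLabel_zero, Int.cast_zero, sub_zero]
  linear_combination (a ^ 2 * ((j : ℝ) + haggLabel alternatingHagg k / 3) ^ 2 / 4) * h3

/-- Squared distance of two hcp sites in coordinates (general labels). [folklore] -/
theorem exactLR_dist_barlowPos_sq (a h : ℝ) (k i j k' i' j' : ℤ) :
    dist (barlowPos a h alternatingHagg k i j) (barlowPos a h alternatingHagg k' i' j') ^ 2 =
      a ^ 2 * (((i : ℝ) - i') ^ 2 + ((i : ℝ) - i') * ((j : ℝ) - j') + ((j : ℝ) - j') ^ 2 +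
        ((haggLabel alternatingHagg k : ℝ) - haggLabel alternatingHagg k') * ((i - i') + (j - j')) +
        ((haggLabel alternatingHagg k : ℝ) - haggLabel alternatingHagg k') ^ 2 / 3) +
      ((k : ℝ) - k') ^ 2 * h ^ 2 := by
  rw [dist_barlowPos_sq]
  have h3 : (√3 : ℝ) ^ 2 = 3 := Real.sq_sqrt (by norm_num)
  linear_combination (a ^ 2 * (((j : ℝ) - j') +
    ((haggLabel alternatingHagg k : ℝ) - haggLabel alternatingHagg k') / 3) ^ 2 / 4) * h3

/-- **Descent inside the basal layer**: a site `(i,j) ≠ 0` of layer `0` has one of its six in-layer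
neighbours (at distance `a ≤ 1`) with squared norm smaller by at least `a² ≥ 1/5`. [folklore] -/
theorem exactLR_descent_inplane {a : ℝ} (h : ℝ) (ha₁ : 47 / 50 ≤ a) (ha₂ : a ≤ 1) {i j : ℤ}
    (hij : ¬ (i = 0 ∧ j = 0)) :
    ∃ i' j' : ℤ, dist (barlowPos a h alternatingHagg 0 i j) (barlowPos a h alternatingHagg 0 i' j')
        ≤ 11 / 10 ∧
      ‖barlowPos a h alternatingHagg 0 i' j'‖ ^ 2 ≤
        ‖barlowPos a h alternatingHagg 0 i j‖ ^ 2 - 1 / 5 := by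
  obtain ⟨di, dj, hN, hlin⟩ : ∃ di dj : ℤ, di ^ 2 + di * dj + dj ^ 2 = 1 ∧
      2 * i * di + i * dj + j * di + 2 * j * dj ≤ -2 := by
    rcases (by omega : 2 ≤ 2 * i + j ∨ 2 * i + j ≤ -2 ∨ 2 ≤ i + 2 * j ∨ i + 2 * j ≤ -2 ∨
        2 ≤ i - j ∨ 2 ≤ j - i) with h0 | h0 | h0 | h0 | h0 | h0
    · exact ⟨-1, 0, by norm_num, by linarith⟩
    · exact ⟨1, 0, by norm_num, by linarith⟩
    · exact ⟨0, -1, by norm_num, by linarith⟩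
    · exact ⟨0, 1, by norm_num, by linarith⟩
    · exact ⟨-1, 1, by norm_num, by linarith⟩
    · exact ⟨1, -1, by norm_num, by linarith⟩
  have hN' : ((di : ℝ)) ^ 2 + di * dj + (dj : ℝ) ^ 2 = 1 := by exact_mod_cast hN
  have hlin' : 2 * (i : ℝ) * di + i * dj + j * di + 2 * j * dj ≤ -2 := by exact_mod_cast hlin
  have ha2 : (47 / 50 : ℝ) ^ 2 ≤ a ^ 2 := pow_le_pow_left₀ (by norm_num) ha₁ 2
  refine ⟨i + di, j + dj, ?_, ?_⟩
  · refine (pow_le_pow_iff_left₀ dist_nonneg (by norm_num : (0 : ℝ) ≤ 11 / 10) two_ne_zero).1 ?_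
    rw [exactLR_dist_barlowPos_sq]
    push_cast
    nlinarith [ha2]
  · rw [exactLR_norm_barlowPos_sq, exactLR_norm_barlowPos_sq, haggLabel_zero]
    push_cast
    have hprod : a ^ 2 * (2 * (i : ℝ) * di + i * dj + j * di + 2 * j * dj + 2) ≤ 0 :=
      mul_nonpos_of_nonneg_of_nonpos (sq_nonneg a) (by linarith)
    have hprod2 : a ^ 2 * (((di : ℝ)) ^ 2 + di * dj + (dj : ℝ) ^ 2) = a ^ 2 := by rw [hN', mul_one]
    nlinarith [hprod, hprod2, ha2]

/-- **Descent off the basal layer**: a site of a layer `k ≠ 0` (label `L ∈ {0,1}`) has a site of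
the adjacent layer closer to the basal one (label `1 − L`) at distance `√(a²/3 + h²) ≤ 11/10` and
with squared norm smaller by at least `min (a²/3 + h²) (3h² − a²/3) ≥ 1/5`. [folklore] -/
theorem exactLR_descent_vertical {a h : ℝ} (ha₁ : 47 / 50 ≤ a) (ha₂ : a ≤ 1)
    (hh₁ : 39 / 50 * a ≤ h) (hh₂ : h ≤ 17 / 20 * a) {k : ℤ} (hk0 : k ≠ 0) (i j : ℤ) :
    ∃ k' i' j' : ℤ,
      dist (barlowPos a h alternatingHagg k i j) (barlowPos a h alternatingHagg k' i' j') ≤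
        11 / 10 ∧
      ‖barlowPos a h alternatingHagg k' i' j'‖ ^ 2 ≤
        ‖barlowPos a h alternatingHagg k i j‖ ^ 2 - 1 / 5 := by
  obtain ⟨k', L, hL, hL', hL01, hkk', hk'2⟩ : ∃ k' L : ℤ, haggLabel alternatingHagg k = L ∧
      haggLabel alternatingHagg k' = 1 - L ∧ (L = 0 ∨ L = 1) ∧ (k - k') ^ 2 = 1 ∧
      k' ^ 2 + 3 - 2 * L ≤ k ^ 2 := by
    rcases Int.even_or_odd k with hk | hk
    · have hk2 : k ≤ -2 ∨ 2 ≤ k := by obtain ⟨m, rfl⟩ := hk; omega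
      rcases hk2 with hk2 | hk2
      · exact ⟨k + 1, 0, haggLabel_alternating_of_even hk, by
          rw [haggLabel_alternating_of_odd hk.add_one]; norm_num, Or.inl rfl, by ring,
          by nlinarith⟩
      · exact ⟨k - 1, 0, haggLabel_alternating_of_even hk, by
          rw [haggLabel_alternating_of_odd (hk.sub_odd odd_one)]; norm_num, Or.inl rfl, by ring,
          by nlinarith⟩
    · have hk1 : k ≤ -1 ∨ 1 ≤ k := by obtain ⟨m, rfl⟩ := hk; omega
      rcases hk1 with hk1 | hk1
      · exact ⟨k + 1, 1, haggLabel_alternating_of_odd hk, by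
          rw [haggLabel_alternating_of_even hk.add_one]; norm_num, Or.inr rfl, by ring,
          by nlinarith⟩
      · exact ⟨k - 1, 1, haggLabel_alternating_of_odd hk, by
          rw [haggLabel_alternating_of_even (hk.sub_odd odd_one)]; norm_num, Or.inr rfl, by ring,
          by nlinarith⟩
  obtain ⟨di, dj, hN, hlin⟩ : ∃ di dj : ℤ, di ^ 2 + di * dj + dj ^ 2 = (2 * L - 1) * (di + dj) ∧
      2 * i * di + i * dj + j * di + 2 * j * dj + L * (di + dj) - (2 * L - 1) * (i + j) ≤ 0 := by
    rcases hL01 with rfl | rfl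
    · rcases (by omega : 0 ≤ i ∨ 0 ≤ j ∨ i + j ≤ 0) with h0 | h0 | h0
      · exact ⟨-1, 0, by norm_num, by omega⟩
      · exact ⟨0, -1, by norm_num, by omega⟩
      · exact ⟨0, 0, by norm_num, by omega⟩
    · rcases (by omega : (0 ≤ i ∧ 0 ≤ j) ∨ i ≤ -1 ∨ j ≤ -1) with h0 | h0 | h0
      · exact ⟨0, 0, by norm_num, by omega⟩
      · exact ⟨1, 0, by norm_num, by omega⟩
      · exact ⟨0, 1, by norm_num, by omega⟩
  have hN' : (di : ℝ) ^ 2 + di * dj + (dj : ℝ) ^ 2 = (2 * L - 1) * (di + dj) := by exact_mod_cast hN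
  have hlin' : 2 * (i : ℝ) * di + i * dj + j * di + 2 * j * dj + L * (di + dj) -
      (2 * L - 1) * (i + j) ≤ 0 := by exact_mod_cast hlin
  have hLL : (L : ℝ) ^ 2 = L := by rcases hL01 with rfl | rfl <;> norm_num
  have hk'2' : (k' : ℝ) ^ 2 + 3 - 2 * L ≤ (k : ℝ) ^ 2 := by exact_mod_cast hk'2
  have ha2 : (47 / 50 : ℝ) ^ 2 ≤ a ^ 2 := pow_le_pow_left₀ (by norm_num) ha₁ 2
  have ha3 : a ^ 2 ≤ 1 := by nlinarith
  have hh2 : (39 / 50 * a) ^ 2 ≤ h ^ 2 := pow_le_pow_left₀ (by linarith) hh₁ 2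
  have hh3 : h ^ 2 ≤ (17 / 20 * a) ^ 2 := pow_le_pow_left₀ (by linarith) hh₂ 2
  have e1 : a ^ 2 * ((di : ℝ) ^ 2 + di * dj + (dj : ℝ) ^ 2) =
      a ^ 2 * ((2 * L - 1) * (di + dj)) := by rw [hN']
  refine ⟨k', i + di, j + dj, ?_, ?_⟩
  · refine (pow_le_pow_iff_left₀ dist_nonneg (by norm_num : (0 : ℝ) ≤ 11 / 10) two_ne_zero).1 ?_
    rw [exactLR_dist_barlowPos_sq, hL, hL']
    push_cast
    have e2 : a ^ 2 * (L : ℝ) ^ 2 = a ^ 2 * L := by rw [hLL]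
    have e3 : ((k : ℝ) - k') ^ 2 * h ^ 2 = h ^ 2 := by
      rw [show ((k : ℝ) - k') ^ 2 = 1 by exact_mod_cast hkk', one_mul]
    nlinarith [e1, e2, e3, ha3, hh3]
  · rw [exactLR_norm_barlowPos_sq, exactLR_norm_barlowPos_sq, hL, hL']
    push_cast
    have e0 : a ^ 2 * (2 * (i : ℝ) * di + i * dj + j * di + 2 * j * dj + L * (di + dj) -
        (2 * L - 1) * (i + j)) ≤ 0 := mul_nonpos_of_nonneg_of_nonpos (sq_nonneg a) hlin'
    have e3 : (k' : ℝ) ^ 2 * h ^ 2 + (3 - 2 * L) * h ^ 2 ≤ (k : ℝ) ^ 2 * h ^ 2 := by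
      nlinarith [sq_nonneg h]
    rcases hL01 with rfl | rfl
    · push_cast at e0 e1 e3 ⊢
      nlinarith [e0, e1, e3, ha3, hh2]
    · push_cast at e0 e1 e3 ⊢
      nlinarith [e0, e1, e3, ha2, hh2]

/-- **(G1) Descent in hcp.** On the box `47/50 ≤ a ≤ 1`, `39/50·a ≤ h ≤ 17/20·a`, every site
`q ≠ 0` of `hcp(a,h)` has a site `q'` with `dist q q' ≤ 11/10` and `‖q'‖² ≤ ‖q‖² − 1/5`.
[folklore] -/
theorem exactLR_descent {a h : ℝ} (ha₁ : 47 / 50 ≤ a) (ha₂ : a ≤ 1) (hh₁ : 39 / 50 * a ≤ h)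
    (hh₂ : h ≤ 17 / 20 * a) {q : EuclideanSpace ℝ (Fin 3)} (hq : q ∈ hcpStacking a h)
    (hq0 : q ≠ 0) :
    ∃ q' ∈ hcpStacking a h, dist q q' ≤ 11 / 10 ∧ ‖q'‖ ^ 2 ≤ ‖q‖ ^ 2 - 1 / 5 := by
  obtain ⟨k, i, j, rfl⟩ := hq
  by_cases hk0 : k = 0
  · subst hk0
    have hij : ¬ (i = 0 ∧ j = 0) := by
      rintro ⟨rfl, rfl⟩
      exact hq0 (exactLR_barlowPos_zero a h)
    obtain ⟨i', j', h1, h2⟩ := exactLR_descent_inplane h ha₁ ha₂ hij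
    exact ⟨_, ⟨0, i', j', rfl⟩, h1, h2⟩
  · obtain ⟨k', i', j', h1, h2⟩ := exactLR_descent_vertical ha₁ ha₂ hh₁ hh₂ hk0 i j
    exact ⟨_, ⟨k', i', j', rfl⟩, h1, h2⟩

/-- **(G2) Covering radius (crude)**: for `0 < a ≤ 1`, `0 < h ≤ 17/20` every point of space is
within `11/5` of a site of an even layer of `hcp(a,h)` (nearest even layer: vertical error `≤ h`;
floor coordinates in the basis `u, v`: horizontal error² `= a²(σ² + στ + τ²) ≤ 3a²`,
`σ, τ ∈ [0,1)`; `3 + (17/20)² < (11/5)²`). [folklore] -/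
theorem exactLR_covering {a h : ℝ} (ha0 : 0 < a) (ha₂ : a ≤ 1) (hh0 : 0 < h) (hh₂ : h ≤ 17 / 20)
    (z : EuclideanSpace ℝ (Fin 3)) : ∃ q ∈ hcpStacking a h, dist z q ≤ 11 / 5 := by
  have h3 : (√3 : ℝ) ^ 2 = 3 := Real.sq_sqrt (by norm_num)
  have h3' : (0 : ℝ) < √3 := by positivity
  set t : ℝ := z 1 / (a * √3 / 2) with ht
  set s : ℝ := z 0 / a - t / 2 with hs
  obtain ⟨m, hm1, hm2⟩ : ∃ m : ℤ, (m : ℝ) ≤ z 2 / (2 * h) + 1 / 2 ∧ z 2 / (2 * h) + 1 / 2 < m + 1 :=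
    ⟨_, Int.floor_le _, Int.lt_floor_add_one _⟩
  refine ⟨barlowPos a h alternatingHagg (2 * m) ⌊s⌋ ⌊t⌋, ⟨2 * m, ⌊s⌋, ⌊t⌋, rfl⟩, ?_⟩
  have hL : haggLabel alternatingHagg (2 * m) = 0 := haggLabel_alternating_of_even (even_two_mul m)
  have hz0 : z 0 = a * (s + t / 2) := by rw [hs]; field_simp; ring
  have hz1 : z 1 = a * √3 / 2 * t := by rw [ht]; field_simp
  have hd : dist z (barlowPos a h alternatingHagg (2 * m) ⌊s⌋ ⌊t⌋) ^ 2 =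
      a ^ 2 * ((s - ⌊s⌋) ^ 2 + (s - ⌊s⌋) * (t - ⌊t⌋) + (t - ⌊t⌋) ^ 2) +
        (z 2 - 2 * m * h) ^ 2 := by
    rw [EuclideanSpace.dist_eq, Real.sq_sqrt (Finset.sum_nonneg fun _ _ => sq_nonneg _),
      Fin.sum_univ_three, Real.dist_eq, Real.dist_eq, Real.dist_eq, sq_abs, sq_abs, sq_abs,
      barlowPos_apply_zero, barlowPos_apply_one, barlowPos_apply_two, hL]
    rw [hz0, hz1]
    push_cast
    linear_combination (a ^ 2 * (t - ⌊t⌋) ^ 2 / 4) * h3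
  have hσ0 : 0 ≤ s - ⌊s⌋ := by linarith [Int.floor_le s]
  have hσ1 : s - ⌊s⌋ ≤ 1 := by linarith [Int.lt_floor_add_one s]
  have hτ0 : 0 ≤ t - ⌊t⌋ := by linarith [Int.floor_le t]
  have hτ1 : t - ⌊t⌋ ≤ 1 := by linarith [Int.lt_floor_add_one t]
  have hQ : (s - ⌊s⌋) ^ 2 + (s - ⌊s⌋) * (t - ⌊t⌋) + (t - ⌊t⌋) ^ 2 ≤ 3 := by
    nlinarith [mul_le_mul hσ1 hσ1 hσ0 zero_le_one, mul_le_mul hσ1 hτ1 hτ0 zero_le_one,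
      mul_le_mul hτ1 hτ1 hτ0 zero_le_one]
  have hv : (z 2 - 2 * m * h) ^ 2 ≤ h ^ 2 := by
    have h2h : (0 : ℝ) < 2 * h := by positivity
    have e : z 2 / (2 * h) * (2 * h) = z 2 := div_mul_cancel₀ _ h2h.ne'
    have hm1' : (m : ℝ) * (2 * h) ≤ z 2 + h := by nlinarith
    have hm2' : z 2 + h ≤ (m + 1 : ℝ) * (2 * h) := by nlinarith
    apply sq_le_sq' <;> linarith
  have ha3 : a ^ 2 ≤ 1 := by nlinarith
  have hh3 : h ^ 2 ≤ (17 / 20) ^ 2 := pow_le_pow_left₀ hh0.le hh₂ 2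
  have hQ0 : 0 ≤ (s - ⌊s⌋) ^ 2 + (s - ⌊s⌋) * (t - ⌊t⌋) + (t - ⌊t⌋) ^ 2 :=
    add_nonneg (add_nonneg (sq_nonneg _) (mul_nonneg hσ0 hτ0)) (sq_nonneg _)
  refine (pow_le_pow_iff_left₀ dist_nonneg (by norm_num : (0 : ℝ) ≤ 11 / 5) two_ne_zero).1 ?_
  rw [hd]
  linarith [mul_le_mul ha3 hQ hQ0 zero_le_one]

/-- **Propagation step.** `P` homogeneous under linear isometries (`P − q = B_q P`) and key-rigid
at radius `5/2`; `X` satisfies the exact radius-`4` local rule modelled on `P` at its points of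
norm `≤ R + 6`. If `X` and `A(P)` agree on `B°₄(A q')`, `q ∈ P`, `‖q‖ ≤ R + 6`, `dist q q' ≤ 11/10`,
then they agree on `B°₄(A q)`: the chart `A_x` of `X` at `x = A q` is compared with `A ∘ B_q`
through the linear isometry `g = B_q⁻¹ A⁻¹ A_x`, a symmetry of `P` by key rigidity
(`B̄_{18/5}(A q) ⊆ B°₄(A q')`). Stated for any finite-dimensional real normed space `E`.
[folklore] -/
theorem exactLR_step {E : Type*} [NormedAddCommGroup E] [NormedSpace ℝ E]
    [FiniteDimensional ℝ E] {P X : Set E}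
    (hhom : ∀ q ∈ P, ∃ B : E ≃ₗᵢ[ℝ] E, ∀ p, p ∈ P ↔ q + B p ∈ P)
    (hkey : ∀ g : E →ₗᵢ[ℝ] E, (∀ p ∈ P, ‖p‖ ≤ 5 / 2 → g p ∈ P) →
      (∀ p ∈ P, ‖p‖ ≤ 5 / 2 → ∃ q ∈ P, g q = p) → ∀ p, p ∈ P ↔ g p ∈ P)
    {R : ℝ} (hrule : ∀ x ∈ X, ‖x‖ ≤ R + 6 → ∃ A : E →ₗᵢ[ℝ] E,
      (∀ p ∈ P, ‖p‖ ≤ 4 → x + A p ∈ X) ∧ (∀ y ∈ X, dist y x < 4 → ∃ p ∈ P, y = x + A p))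
    (A : E →ₗᵢ[ℝ] E) {q q' : E} (hq : q ∈ P) (hqR : ‖q‖ ≤ R + 6) (hqq' : dist q q' ≤ 11 / 10)
    (hC : ∀ y, dist y (A q') < 4 → (y ∈ X ↔ ∃ p ∈ P, y = A p)) :
    ∀ y, dist y (A q) < 4 → (y ∈ X ↔ ∃ p ∈ P, y = A p) := by
  have hxq' : dist (A q) (A q') < 4 := by rw [A.dist_map]; linarith
  have hxR : ‖A q‖ ≤ R + 6 := by rwa [A.norm_map]
  obtain ⟨Ax, hAx1, hAx2⟩ := hrule (A q) ((hC (A q) hxq').2 ⟨q, hq, rfl⟩) hxR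
  obtain ⟨B, hB⟩ := hhom q hq
  set Ae : E ≃ₗᵢ[ℝ] E := A.toLinearIsometryEquiv rfl with hAe
  have hAe_apply : ∀ z, Ae z = A z := fun z => rfl
  set g : E →ₗᵢ[ℝ] E := (B.symm.toLinearIsometry.comp Ae.symm.toLinearIsometry).comp Ax with hg
  have hg_apply : ∀ p, g p = B.symm (Ae.symm (Ax p)) := fun p => rfl
  have hABg : ∀ p, A (B (g p)) = Ax p := fun p => by
    rw [hg_apply, B.apply_symm_apply, ← hAe_apply, Ae.apply_symm_apply]
  have hg1 : ∀ p ∈ P, ‖p‖ ≤ 5 / 2 → g p ∈ P := by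
    intro p hp hp52
    have h2 : dist (A q + Ax p) (A q') < 4 := by
      have := dist_triangle (A q + Ax p) (A q) (A q')
      rw [dist_self_add_left, Ax.norm_map, A.dist_map] at this
      linarith
    obtain ⟨p'', hp'', he⟩ := (hC _ h2).1 (hAx1 p hp (by linarith))
    have hAxp : Ax p = A (p'' - q) := by rw [map_sub, ← he, add_sub_cancel_left]
    have hgp : g p = B.symm (p'' - q) := by
      rw [hg_apply, hAxp, ← hAe_apply, Ae.symm_apply_apply]
    rw [hB, hgp, B.apply_symm_apply, add_sub_cancel]
    exact hp''
  have hg2 : ∀ p ∈ P, ‖p‖ ≤ 5 / 2 → ∃ p₀ ∈ P, g p₀ = p := by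
    intro p hp hp52
    have h2 : dist (A (q + B p)) (A q') < 4 := by
      have := dist_triangle (q + B p) q q'
      rw [dist_self_add_left, B.norm_map] at this
      rw [A.dist_map]
      linarith
    have h4 : dist (A (q + B p)) (A q) < 4 := by
      rw [A.dist_map, dist_self_add_left, B.norm_map]; linarith
    obtain ⟨p'', hp'', he⟩ := hAx2 _ ((hC _ h2).2 ⟨_, (hB p).1 hp, rfl⟩) h4
    refine ⟨p'', hp'', ?_⟩
    have hAxp : Ax p'' = A (B p) := by rw [map_add] at he; exact (add_left_cancel he).symm
    rw [hg_apply, hAxp, ← hAe_apply, Ae.symm_apply_apply, B.symm_apply_apply]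
  have hgP : ∀ p, p ∈ P ↔ g p ∈ P := hkey g hg1 hg2
  intro y hy
  constructor
  · intro hyX
    obtain ⟨p, hp, rfl⟩ := hAx2 y hyX hy
    refine ⟨q + B (g p), (hB _).1 ((hgP p).1 hp), ?_⟩
    rw [map_add, hABg]
  · rintro ⟨p', hp', rfl⟩
    have hp'' : B.symm (p' - q) ∈ P := by rw [hB, B.apply_symm_apply, add_sub_cancel]; exact hp'
    set Axe : E ≃ₗᵢ[ℝ] E := Ax.toLinearIsometryEquiv rfl with hAxe
    have hAxp : Ax (Axe.symm (A (p' - q))) = A (p' - q) := Axe.apply_symm_apply _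
    have hgp : g (Axe.symm (A (p' - q))) = B.symm (p' - q) := by
      rw [hg_apply, hAxp, ← hAe_apply, Ae.symm_apply_apply]
    have hpP : Axe.symm (A (p' - q)) ∈ P := by rw [hgP, hgp]; exact hp''
    have hpn : ‖Axe.symm (A (p' - q))‖ ≤ 4 := by
      rw [← Ax.norm_map, hAxp, A.norm_map, ← dist_eq_norm, ← A.dist_map]
      exact hy.le
    have := hAx1 _ hpP hpn
    rwa [hAxp, map_sub, add_sub_cancel] at this

/-- **Propagation to all sites of norm `≤ R + 6`**, by induction on `⌈5‖q‖²⌉` along neighbour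
steps of length `≤ 11/10` lowering `‖·‖²` by `≥ 1/5` (`hdesc`), starting from the chart `A` at
`0 ∈ X` (`hA1`, `hA2`: the local rule at `0`). [folklore] -/
theorem exactLR_propagate {E : Type*} [NormedAddCommGroup E] [NormedSpace ℝ E]
    [FiniteDimensional ℝ E] {P X : Set E}
    (hhom : ∀ q ∈ P, ∃ B : E ≃ₗᵢ[ℝ] E, ∀ p, p ∈ P ↔ q + B p ∈ P)
    (hkey : ∀ g : E →ₗᵢ[ℝ] E, (∀ p ∈ P, ‖p‖ ≤ 5 / 2 → g p ∈ P) →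
      (∀ p ∈ P, ‖p‖ ≤ 5 / 2 → ∃ q ∈ P, g q = p) → ∀ p, p ∈ P ↔ g p ∈ P)
    {R : ℝ} (hrule : ∀ x ∈ X, ‖x‖ ≤ R + 6 → ∃ A : E →ₗᵢ[ℝ] E,
      (∀ p ∈ P, ‖p‖ ≤ 4 → x + A p ∈ X) ∧ (∀ y ∈ X, dist y x < 4 → ∃ p ∈ P, y = x + A p))
    (hdesc : ∀ q ∈ P, q ≠ 0 → ∃ q' ∈ P, dist q q' ≤ 11 / 10 ∧ ‖q'‖ ^ 2 ≤ ‖q‖ ^ 2 - 1 / 5)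
    (A : E →ₗᵢ[ℝ] E) (hA1 : ∀ p ∈ P, ‖p‖ ≤ 4 → (0 : E) + A p ∈ X)
    (hA2 : ∀ y ∈ X, dist y (0 : E) < 4 → ∃ p ∈ P, y = (0 : E) + A p) :
    ∀ q ∈ P, ‖q‖ ≤ R + 6 → ∀ y, dist y (A q) < 4 → (y ∈ X ↔ ∃ p ∈ P, y = A p) := by
  have hC0 : ∀ y, dist y (A 0) < 4 → (y ∈ X ↔ ∃ p ∈ P, y = A p) := by
    intro y hy
    rw [map_zero] at hy
    refine ⟨fun hyX => ?_, ?_⟩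
    · obtain ⟨p, hp, rfl⟩ := hA2 y hyX hy
      exact ⟨p, hp, zero_add _⟩
    · rintro ⟨p, hp, rfl⟩
      have hp4 : ‖p‖ ≤ 4 := by rw [← A.norm_map, ← dist_zero_right]; exact hy.le
      simpa only [zero_add] using hA1 p hp hp4
  suffices H : ∀ m : ℕ, ∀ q ∈ P, ‖q‖ ≤ R + 6 → ‖q‖ ^ 2 ≤ m / 5 →
      ∀ y, dist y (A q) < 4 → (y ∈ X ↔ ∃ p ∈ P, y = A p) by
    intro q hq hqR
    exact H ⌈5 * ‖q‖ ^ 2⌉₊ q hq hqR (by have := Nat.le_ceil (5 * ‖q‖ ^ 2); linarith)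
  intro m
  induction m with
  | zero =>
    intro q _ _ hq0
    obtain rfl : q = 0 := norm_eq_zero.1 (by nlinarith [norm_nonneg q])
    exact hC0
  | succ m ih =>
    intro q hq hqR hqm
    by_cases hq0 : q = 0
    · subst hq0; exact hC0
    obtain ⟨q', hq', hd, hn⟩ := hdesc q hq hq0
    have hle : ‖q'‖ ≤ ‖q‖ :=
      (pow_le_pow_iff_left₀ (norm_nonneg _) (norm_nonneg _) two_ne_zero).1 (by linarith)
    push_cast at hqm
    exact exactLR_step hhom hkey hrule A hq hqR hd (ih q' hq' (by linarith) (by linarith))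

/-- **Stub E — exact local rules imply a global chart** (line `vanishing-excess-truss-rigidity`,
crux `CoarseGrains`). For `(a,h)` in the box `47/50 ≤ a ≤ 1`, `39/50·a ≤ h ≤ 17/20·a`, given key
rigidity of `P = hcp(a,h)` at radius `5/2` (as a hypothesis): if a set `X ∋ 0` satisfies the EXACT
radius-`4` local rule modelled on `P` at every `x ∈ X` with `‖x‖ ≤ R + 6`, then one linear
isometry (the chart at `0`) charts `X` on `B̄_{R+1}` two-way (`exactLR_propagate` + homogeneity,
descent and covering of hcp). [folklore] -/
theorem stub_exactLocalRules :
    ∀ (a h : ℝ) (ha : a ≠ 0) (hh : h ≠ 0), 47 / 50 ≤ a → a ≤ 1 → 39 / 50 * a ≤ h → h ≤ 17 / 20 * a →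
    (∀ g : EuclideanSpace ℝ (Fin 3) →ₗᵢ[ℝ] EuclideanSpace ℝ (Fin 3),
      (∀ p ∈ (hcpPeriodicConfiguration ha hh).points, ‖p‖ ≤ 5 / 2 →
        g p ∈ (hcpPeriodicConfiguration ha hh).points) →
      (∀ p ∈ (hcpPeriodicConfiguration ha hh).points, ‖p‖ ≤ 5 / 2 →
        ∃ q ∈ (hcpPeriodicConfiguration ha hh).points, g q = p) →
      ∀ p, p ∈ (hcpPeriodicConfiguration ha hh).points ↔
        g p ∈ (hcpPeriodicConfiguration ha hh).points) →
    ∀ R : ℝ, 0 < R → ∀ X : Set (EuclideanSpace ℝ (Fin 3)), (0 : EuclideanSpace ℝ (Fin 3)) ∈ X →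
      (∀ x ∈ X, ‖x‖ ≤ R + 6 → ∃ A : EuclideanSpace ℝ (Fin 3) →ₗᵢ[ℝ] EuclideanSpace ℝ (Fin 3),
        (∀ p ∈ (hcpPeriodicConfiguration ha hh).points, ‖p‖ ≤ 4 → x + A p ∈ X) ∧
        (∀ y ∈ X, dist y x < 4 → ∃ p ∈ (hcpPeriodicConfiguration ha hh).points, y = x + A p)) →
      ∃ A : EuclideanSpace ℝ (Fin 3) →ₗᵢ[ℝ] EuclideanSpace ℝ (Fin 3),
        (∀ p ∈ (hcpPeriodicConfiguration ha hh).points, ‖p‖ ≤ R + 1 → A p ∈ X) ∧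
        (∀ y ∈ X, ‖y‖ ≤ R + 1 → ∃ p ∈ (hcpPeriodicConfiguration ha hh).points, y = A p) := by
  intro a h ha hh ha₁ ha₂ hh₁ hh₂ hkey R hR X hX0 hrule
  have hP := hcpPeriodicConfiguration_points ha hh
  obtain ⟨A, hA1, hA2⟩ := hrule 0 hX0 (by rw [norm_zero]; linarith)
  have hdesc : ∀ q ∈ (hcpPeriodicConfiguration ha hh).points, q ≠ 0 →
      ∃ q' ∈ (hcpPeriodicConfiguration ha hh).points,
        dist q q' ≤ 11 / 10 ∧ ‖q'‖ ^ 2 ≤ ‖q‖ ^ 2 - 1 / 5 := by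
    rw [hP]; exact fun q hq hq0 => exactLR_descent ha₁ ha₂ hh₁ hh₂ hq hq0
  have hall := exactLR_propagate (fun q hq => hcpPeriodicConfiguration_homogeneous a h ha hh hq)
    hkey hrule hdesc A hA1 hA2
  refine ⟨A, fun p hp hpR => ?_, fun y hy hyR => ?_⟩
  · exact (hall p hp (by linarith) (A p) (by rw [dist_self]; norm_num)).2 ⟨p, hp, rfl⟩
  · set Ae := A.toLinearIsometryEquiv rfl with hAe
    obtain ⟨q, hq, hzq⟩ :=
      exactLR_covering (h := h) (by linarith) ha₂ (by linarith) (by linarith) (Ae.symm y)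
    rw [← hP] at hq
    have hyq : dist y (A q) ≤ 11 / 5 := by rwa [← Ae.dist_map, Ae.apply_symm_apply] at hzq
    have hqR : ‖q‖ ≤ R + 6 := by
      have := norm_le_insert' (A q) y
      rw [← dist_eq_norm, dist_comm, A.norm_map] at this
      linarith
    exact (hall q hq hqR y (by linarith)).1 hy

end Summit.AtomisticToContinuum.Crystallization.Theorems.ExcessDecayLiouvilleCoarseGrains

end
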